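import Literature.Probability.RandomPlanarGeometry.HexSAWPolygonStepTwoLeafSlide
import Literature.Probability.RandomPlanarGeometry.HexSAWPolygonStepTwoLeafCrown
import HarnessLib

/-!
# The step `2` for honeycomb polygon numbers, FIFTH SLOT: the FLOOR SLIDE at a bottom-right leaf with a long support
# `#{X ∪ Y⋆ ∪ (leaf ∩ bottom-served) ∪ (floor-slide ∩ top-leaf)} ≤ q_{N+2}(ℍ)`

Topic `Literature/Probability/RandomPlanarGeometry` (lane «pcv-sawmu», a-p4 g20; the y-MIRROR IMAGE of `HexSAWPolygonStepTwoLeafSlide.lean`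
at the BOTTOM corner (it imports the slide file for the shared index lemma `rd_ten_five`), on top of `HexSAWPolygonStepTwoLeafCrown.lean` — `IsBotLeaf`, `botSix_of_isBotLeaf`, `not_isBotLeaf_of_bottomDatum` —,
`HexSAWPolygonStepTwoTwoCorner.lean` — `BotSix`, `botAt_unique`, `botAt_spliceAdd`, `botAt_spliceXb`, `botAt_spliceYsb`, `ne_of_low`,
`bottom_corner_pred/succ`, `notXb_pred_fwd`, `notXb_succ_bwd`, `spliceYsb_sites_fwd/bwd`, `BottomDatum`, `exists_stepTwoBottom_image`,
`eq_of_stepTwoBottom_image_eq`, `isTopLeaf_of_bottomDatum`, `IsStepTwoTwoCorner` —, of `HexSAWPolygonStepTwoYStar.lean` — `IsTopLeaf`,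
`RoofDatum`, `exists_stepTwoRoof_image`, `eq_of_stepTwoRoof_image_eq`, `not_isTopLeaf_of_roofDatum`, `isStepTwoRoof_or_isTopLeaf` — and of
`HexSAWPolygonStepTwoMain.lean` / `HexSAWPolygonStepSix.lean` — `spliceAdd`, `SpliceAddOK`, `spliceAddOK_of_tables`, `eq_of_spliceAdd_eq`,
`spliceAdd_site_cases`, `tpath`, `rd`, `w6A`).

After the four slots (two corners, leaf slide, leaf crown) the residue of the honeycomb step two is the «domino antenna» class: the top-right
hexagon is an up-right leaf whose support run has length ONE.  Its bottom-right hexagon is a down-right leaf, and when THAT leaf's support run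
is long — the hexagon left of its support hexagon is present: in walk terms the site five steps away from the bottom corner `(xb, L) = ω i₀`
on the support side is `(xb−4, L+1)` — and the hexagon two places left of the bottom-right hexagon is absent (`(xb−4, L)` off `ω`), the
mirror image of the leaf slide applies at the bottom: remove the bottom-right hexagon, re-attach it one place to the left, hang a down-left
leaf under it.  On the boundary walk: ONE window of `8` bonds, `(xb−4,L+1)(xb−3,L+1)(xb−2,L+1)(xb−2,L)(xb−1,L)(xb,L)(xb,L+1)(xb−1,L+1)(xb−1,L+2)`,
replaced by the `10`-bond path `(xb−4,L+1)(xb−4,L)(xb−5,L)(xb−5,L−1)(xb−4,L−1)(xb−3,L−1)(xb−3,L)(xb−2,L)(xb−2,L+1)(xb−1,L+1)(xb−1,L+2)`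
(tables `wUb`, `offUb`; `spliceAdd 2 8`).  ROOT: the new sites have abscissae `≥ xb − 5` and heights `≥ L − 1`, so the surgery stays in the
canonical frame iff `xb ≥ 6` — the class below asks for it (the `xb = 5` sources, `22` of `117` at `N = 30`, need the re-rooting of
`HexSAWPolygonReRoot` and are left aside).  The image's bottom corner is `(xb−3, L−1)`; above it the walk turns RIGHT (a down-LEFT leaf), and
the image carries `(xb−4, L)` — which separates floor-slide images from every bottom-leaf walk and from the bottom images of the two-corner
map (`spliceUb_ne_bottom`).  The surgery changes sites of height `≤ L + 1` in the open window only, so a TOP leaf survives it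
(`isTopLeaf_spliceAdd_low`): the image is top-leaf, hence not a top image.

PART I: tables, `spliceOK_Ub`, the forced window `stepTwo_data_Ub_fwd/bwd`, `botfree5_of_free4`, the image corner `botAt_spliceUb`, image
sites, `spliceUb_decode`, `not_isBotLeaf_spliceUb`, `spliceXb_free_under`, `spliceUb_ne_bottom`.  PART II: `isTopLeaf_spliceAdd_low`.
PART III: the class `IsFloorSlide`, `FloorSlideDatum`, `exists_floorSlide_image`, `eq_of_floorSlide_image_eq`, `isTopLeaf_of_floorSlideDatum`,
and ★ **`card_filter_isStepTwoFloorSlot_le : 5 ≤ n → #{ω ∈ canonEnd n | IsStepTwoTwoCorner n ω ∨ (IsFloorSlide n ω ∧ IsTopLeaf n ω)} ≤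
#canonEnd (n+2)`**, complement and printed forms.

NOT claimed: `q_N(ℍ) ≤ q_{N+2}(ℍ)`; the joint assembly with the slide and the crown (their images are pairwise distinct from floor-slide images:
slide images are not top-leaf; crown images are bottom-leaf; floor-slide images are top-leaf and not bottom-leaf — left to the sequel).
Numerically (`HOME/pub-sawmu-a-p4/g20/three/py/slideUV2.py`) the floor slide serves `95` of the `306` domino antennas at `N = 30` (the
`xb = 5` cases excluded).  Label (lane): LANE LEMMA / infrastructure for an open combinatorial item; no literature claim beyond the
transplanted `ℤ^d` method.
-/

noncomputable section

open Finset Function Literature.Probability.LatticeModels Literature.Probability.Percolation SimpleGraph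

namespace Literature.Probability.RandomPlanarGeometry.SAW

namespace HexBW

namespace PolygonConcat

variable {n : ℕ} {ω : ℕ → Site 2}

/-- Two sites of `ℤ²` are equal iff both coordinates agree. [folklore; lane plumbing] [cite: MadrasSlade1993, §1.1] -/
private theorem fs_site_eq_iff {x y : Site 2} : x = y ↔ x 0 = y 0 ∧ x 1 = y 1 := by
  constructor
  · rintro rfl; exact ⟨rfl, rfl⟩
  · rintro ⟨h0, h1⟩; funext i; fin_cases i <;> assumption

/-- `pt a b` is lexicographically `≥ 0` when `a > 0`, or `a = 0 ≤ b`. [cite: MadrasSlade1993, §3.2 (proof of Theorem 3.2.3: `Q[N]`)] -/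
private theorem fs_lexNonneg_pt {a b : ℤ} (h : 0 < a ∨ (a = 0 ∧ 0 ≤ b)) : LexNonneg (pt a b) := by
  unfold LexNonneg; simpa using h

/-! ### PART I — the floor slide as a fixed-window surgery -/

section FloorTables

variable {xb L : ℤ} {fwd : Bool} {j : ℕ}

/-- Window table of the floor slide (offsets from the bottom corner `(xb,L)`; the table `wU` of the leaf slide with negated heights).
[cite: MadrasSlade1993, §3.2 (proof of Theorem 3.2.3: local surgery at an extreme point)] -/
def wUb : ℕ → ℤ × ℤ
  | 0 => (-4, 1) | 1 => (-3, 1) | 2 => (-2, 1) | 3 => (-2, 0) | 4 => (-1, 0) | 5 => (0, 0) | 6 => (0, 1) | 7 => (-1, 1)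
  | _ => (-1, 2)

/-- New-path table of the floor slide (the table `offU` with negated heights). [cite: MadrasSlade1993, §3.2 (proof of Theorem 3.2.3: local surgery)] -/
def offUb : ℕ → ℤ × ℤ
  | 0 => (-4, 1) | 1 => (-4, 0) | 2 => (-5, 0) | 3 => (-5, -1) | 4 => (-4, -1) | 5 => (-3, -1) | 6 => (-3, 0) | 7 => (-2, 0)
  | 8 => (-2, 1) | 9 => (-1, 1) | _ => (-1, 2)

/-- Table U♭ is a brick-wall path (given the bottom-corner parity `xb + L` even). [cite: EntingJensen2009, §7.4.2, Fig. 7.10] -/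
theorem offUb_adj (hpar : (xb + L) % 2 = 0) {s : ℕ} (hs : s < 10) :
    brickWallGraph.Adj (pt (xb + (offUb s).1) (L + (offUb s).2)) (pt (xb + (offUb (s + 1)).1) (L + (offUb (s + 1)).2)) := by
  interval_cases s <;> simp only [offUb] <;> exact adj_pt_iff.2 (by omega)

/-- Table U♭ is injective on `[0,10]`. [cite: MadrasSlade1993, §3.2] -/
theorem offUb_inj {s s' : ℕ} (hs : s ≤ 10) (hs' : s' ≤ 10)
    (h : pt (xb + (offUb s).1) (L + (offUb s).2) = pt (xb + (offUb s').1) (L + (offUb s').2)) : s = s' := by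
  interval_cases s <;> interval_cases s' <;> simp only [offUb] at h <;>
    first | rfl | (obtain ⟨h1, h2⟩ := pt_inj.1 h; omega)

/-- **The floor slide is admissible**: for `xb ≥ 6`, the sites `(xb−3,L)`, `(xb−4,L)`, `(xb−5,L)` off `ω`, and the window `wUb` read on
`ω` from time `j`, the new path satisfies `SpliceAddOK n 2 8` (freshness: three new sites lie below the bottom row; three are off `ω` by
hypothesis; three are window sites; every new abscissa is `≥ xb − 5 ≥ 1`). [cite: MadrasSlade1993, §3.2 (proof of Theorem 3.2.3: local surgery)] -/
theorem spliceOK_Ub (hω : ω ∈ endAt n (Pi.single 0 1 : Site 2)) (hpar : (xb + L) % 2 = 0) (hx : 6 ≤ xb)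
    (hminH : ∀ i, i ≤ n → L ≤ ω i 1) (hmaxX : ∀ i, i ≤ n → ω i 1 = L → ω i 0 ≤ xb)
    (hX3 : ∀ t, t ≤ n → ω t ≠ pt (xb - 3) L) (hX4 : ∀ t, t ≤ n → ω t ≠ pt (xb - 4) L) (hX5 : ∀ t, t ≤ n → ω t ≠ pt (xb - 5) L)
    (hw : ∀ s, s ≤ 8 → ω (j + s) = tpath wUb 8 xb L fwd s) (hwnd : j + 8 ≤ n) :
    SpliceAddOK n 2 8 ω j (tpath offUb 10 xb L fwd) := by
  have hinj := (mem_endAt_iff.1 hω).1.2.2.2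
  have hwin : ∀ u, u ≤ 8 → ∀ i, i ≤ n → (i < j ∨ j + 8 < i) → pt (xb + (wUb u).1) (L + (wUb u).2) ≠ ω i := by
    intro u hu i hi hio he
    have hs : ∃ s, s ≤ 8 ∧ rd fwd 8 s = u := by
      cases fwd
      · exact ⟨8 - u, by omega, by unfold rd; simp; omega⟩
      · exact ⟨u, hu, by unfold rd; simp⟩
    obtain ⟨s, hs8, hsu⟩ := hs
    have e : ω (j + s) = pt (xb + (wUb u).1) (L + (wUb u).2) := by rw [hw s hs8, tpath, hsu]
    have := hinj (show j + s ∈ {i | i ≤ n} by simp; omega) (show i ∈ {i | i ≤ n} by simpa using hi) (by rw [e, he])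
    omega
  refine spliceAddOK_of_tables (L := 8) (K := 2) (w := wUb) (by norm_num) (by rfl) (by rfl) (fun s hs => offUb_adj hpar hs)
    (fun s s' hs hs' h => offUb_inj hs hs' h) (fun u hu0 hu1 i hi hio => ?_) (fun u hu => ?_) hw hwnd
  · interval_cases u <;> simp only [offUb]
    · exact fun h => hX4 i hi (h.symm.trans (pt_inj.2 ⟨by ring, by ring⟩))
    · exact fun h => hX5 i hi (h.symm.trans (pt_inj.2 ⟨by ring, by ring⟩))
    · exact ne_of_low hminH hmaxX (by omega) hi
    · exact ne_of_low hminH hmaxX (by omega) hi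
    · exact ne_of_low hminH hmaxX (by omega) hi
    · exact fun h => hX3 i hi (h.symm.trans (pt_inj.2 ⟨by ring, by ring⟩))
    · exact hwin 3 (by norm_num) i hi hio
    · exact hwin 2 (by norm_num) i hi hio
    · exact hwin 7 (by norm_num) i hi hio
  · interval_cases u <;> simp only [offUb] <;> exact fs_lexNonneg_pt (by omega)

end FloorTables


/-! ### The forced window around a bottom-right leaf with a long support -/

section FloorData

variable {xb L : ℤ}

/-- **A bottom-row site has both horizontal walk-neighbours**: if `(xb−4, L)` is off `ω` and `xb ≥ 6` then `(xb−5, L)` is off `ω` (its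
vertical bond points down, below the bottom row; its right neighbour is `(xb−4,L)`; if it is the end `e₀` of the walk its one walk-neighbour
would be the root, forcing `n = 1`). [cite: EntingJensen2009, §7.4.2, Fig. 7.10 (brickwork form of the honeycomb lattice)] -/
theorem botfree5_of_free4 (hω : ω ∈ endAt n (Pi.single 0 1 : Site 2)) (hn : 2 ≤ n) (hpar : (xb + L) % 2 = 0) (hx : 6 ≤ xb)
    (hminH : ∀ i, i ≤ n → L ≤ ω i 1) (hX4 : ∀ t, t ≤ n → ω t ≠ pt (xb - 4) L) :
    ∀ t, t ≤ n → ω t ≠ pt (xb - 5) L := by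
  obtain ⟨⟨h0, -, hbw, hinj⟩, hn'⟩ := mem_endAt_iff.1 hω
  intro t ht he
  have ht0 : t ≠ 0 := by intro h; rw [h, h0] at he; have := congrFun he 0; simp at this; omega
  have key : ∀ i, i ≤ n → brickWallGraph.Adj (ω t) (ω i) → ω i = pt (xb - 6) L := by
    intro i hi hadj
    rw [he] at hadj
    rcases adj_cases hadj with ⟨hz0, hz1⟩ | ⟨hz0, hz1⟩ | hz0
    · exfalso; apply hX4 i hi; rw [fs_site_eq_iff]; simp only [pt_apply_zero, pt_apply_one] at hz0 hz1 ⊢; omega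
    · rw [fs_site_eq_iff]; simp only [pt_apply_zero, pt_apply_one] at hz0 hz1 ⊢; omega
    · rcases vertical_cases hadj hz0 with ⟨hy, hp⟩ | ⟨hy, hp⟩
      · exfalso; simp only [pt_apply_zero, pt_apply_one] at hz0 hy hp; omega
      · exfalso; have := hminH i hi; simp only [pt_apply_one] at hy; omega
  have h2 := key (t - 1) (by omega)
    (by have := hbw (t - 1) (by omega); rw [show t - 1 + 1 = t by omega] at this; exact this.symm)
  rcases eq_or_lt_of_le ht with htn | htn
  · -- `t = n`: the site is `e₀ = (1,0)`, so `xb = 6`, `L = 0`, and `ω (n−1) = (0,0) = ω 0`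
    rw [htn, hn'] at he
    have e0 := congrFun he 0; have e1 := congrFun he 1; simp at e0 e1
    have : ω (t - 1) = ω 0 := by rw [h2, h0, fs_site_eq_iff]; simp; omega
    have := hinj (show t - 1 ∈ {i | i ≤ n} by simp; omega) (show 0 ∈ {i | i ≤ n} by simp) this
    omega
  · have h1 := key (t + 1) (by omega) (hbw t htn)
    have := hinj (show t + 1 ∈ {i | i ≤ n} by simp; omega) (show t - 1 ∈ {i | i ≤ n} by simp; omega) (by rw [h1, h2])
    omega

/-- **Floor-slide datum, forward.**  At a bottom corner `ω i₀ = (xb,L)` of the bottom-LEAF class (`(xb−3,L)` off `ω`, `ω (i₀+1) = (xb,L+1)`,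
`ω (i₀+2) = (xb−1,L+1)`) whose support run is long (`ω (i₀−5) = (xb−4,L+1)`) and with `(xb−4,L)` off `ω` and `xb ≥ 6`, the `8`-window from
time `i₀ − 5` is forced and the floor slide is admissible there. [cite: MadrasSlade1993, §3.2 (proof of Theorem 3.2.3: the local structure at an extreme point)] -/
theorem stepTwo_data_Ub_fwd (hω : ω ∈ canonEnd n) {i₀ : ℕ} (hi₀n : i₀ + 2 ≤ n) (hv : ω i₀ = pt xb L) (hx : 6 ≤ xb)
    (hminH : ∀ i, i ≤ n → L ≤ ω i 1) (hmaxX : ∀ i, i ≤ n → ω i 1 = L → ω i 0 ≤ xb)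
    (hX3 : ∀ t, t ≤ n → ω t ≠ pt (xb - 3) L) (hX4 : ∀ t, t ≤ n → ω t ≠ pt (xb - 4) L)
    (hs1 : ω (i₀ + 1) = pt xb (L + 1)) (hs2 : ω (i₀ + 2) = pt (xb - 1) (L + 1))
    (hi₀5 : 5 ≤ i₀) (hp5 : ω (i₀ - 5) = pt (xb - 4) (L + 1)) :
    i₀ + 3 ≤ n ∧ SpliceAddOK n 2 8 ω (i₀ - 5) (tpath offUb 10 xb L true) ∧
      (∀ s, s ≤ 8 → ω (i₀ - 5 + s) = tpath wUb 8 xb L true s) := by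
  obtain ⟨hE, hlex⟩ := mem_canonEnd.1 hω
  obtain ⟨⟨h0, -, hbw, hinj⟩, hn'⟩ := mem_endAt_iff.1 hE
  have hpar : (xb + L) % 2 = 0 := by
    have hvc := vertical_cases (hbw i₀ (by omega)) (by rw [hv, hs1]; simp)
    rw [hv, hs1] at hvc; simp only [pt_apply_zero, pt_apply_one] at hvc; omega
  -- `ω (i₀−1) = (xb−1, L)`: the other walk-neighbour of the corner (right and down are excluded by extremality, up is the successor)
  have hi₀1 : 1 ≤ i₀ := by omega
  have p1 : ω (i₀ - 1) = pt (xb - 1) L := by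
    have hadj : brickWallGraph.Adj (ω i₀) (ω (i₀ - 1)) := by
      have := hbw (i₀ - 1) (by omega); rw [show i₀ - 1 + 1 = i₀ by omega] at this; exact this.symm
    rw [hv] at hadj
    have hne : ω (i₀ - 1) ≠ ω (i₀ + 1) := fun h => by
      have := hinj (show i₀ - 1 ∈ {i | i ≤ n} by simp; omega) (show i₀ + 1 ∈ {i | i ≤ n} by simp; omega) h; omega
    rcases adj_cases hadj with ⟨hz0, hz1⟩ | ⟨hz0, hz1⟩ | hz0
    · exfalso; have := hmaxX (i₀ - 1) (by omega) (by simp only [pt_apply_one] at hz1; omega)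
      simp only [pt_apply_zero] at hz0; omega
    · rw [fs_site_eq_iff]; simp only [pt_apply_zero, pt_apply_one] at hz0 hz1 ⊢; omega
    · rcases vertical_cases hadj hz0 with ⟨hy, hp⟩ | ⟨hy, hp⟩
      · exfalso; apply hne; rw [hs1, fs_site_eq_iff]; simp only [pt_apply_zero, pt_apply_one] at hz0 hy ⊢; omega
      · exfalso; have := hminH (i₀ - 1) (by omega); simp only [pt_apply_one] at hy; omega
  obtain ⟨hi₀2, p2⟩ := bottom_corner_pred hω hi₀1 (by omega) hv (by omega) hminH p1 hs1
  obtain ⟨hi₀3, p3⟩ := notXb_pred_fwd hE hpar hminH hi₀2 (by omega) p2 p1 hX3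
  -- `ω (i₀−4) = (xb−3, L+1)`: from `(xb−2,L+1)` the vertical bond goes down to `ω (i₀−2)`, the right neighbour is `ω (i₀+2)`
  have p4 : ω (i₀ - 4) = pt (xb - 3) (L + 1) := by
    have hadj : brickWallGraph.Adj (ω (i₀ - 3)) (ω (i₀ - 4)) := by
      have := hbw (i₀ - 4) (by omega); rw [show i₀ - 4 + 1 = i₀ - 3 by omega] at this; exact this.symm
    rw [p3] at hadj
    have hne2 : ω (i₀ - 4) ≠ ω (i₀ + 2) := fun h => by
      have := hinj (show i₀ - 4 ∈ {i | i ≤ n} by simp; omega) (show i₀ + 2 ∈ {i | i ≤ n} by simp; omega) h; omega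
    have hne3 : ω (i₀ - 4) ≠ ω (i₀ - 2) := fun h => by
      have := hinj (show i₀ - 4 ∈ {i | i ≤ n} by simp; omega) (show i₀ - 2 ∈ {i | i ≤ n} by simp; omega) h; omega
    rcases adj_cases hadj with ⟨hz0, hz1⟩ | ⟨hz0, hz1⟩ | hz0
    · exfalso; apply hne2; rw [hs2, fs_site_eq_iff]; simp only [pt_apply_zero, pt_apply_one] at hz0 hz1 ⊢; omega
    · rw [fs_site_eq_iff]; simp only [pt_apply_zero, pt_apply_one] at hz0 hz1 ⊢; omega
    · rcases vertical_cases hadj hz0 with ⟨hy, hp⟩ | ⟨hy, hp⟩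
      · exfalso; simp only [pt_apply_zero, pt_apply_one] at hz0 hy hp; omega
      · exfalso; apply hne3; rw [p2, fs_site_eq_iff]; simp only [pt_apply_zero, pt_apply_one] at hz0 hy ⊢; omega
  -- `i₀ ≥ 6`: otherwise `ω (i₀−5)` is the root, so `xb = 4`
  have hi₀6 : 6 ≤ i₀ := by
    by_contra hlt
    have h5 : i₀ - 5 = 0 := by omega
    rw [h5, h0] at hp5
    have e0 := congrFun hp5 0; simp at e0; omega
  -- `ω (i₀−6) = (xb−5, L+1)`: from `(xb−4,L+1)` the vertical bond goes down to `(xb−4,L)` (off `ω`), the right neighbour is `ω (i₀−4)`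
  have p6 : ω (i₀ - 6) = pt (xb - 5) (L + 1) := by
    have hadj : brickWallGraph.Adj (ω (i₀ - 5)) (ω (i₀ - 6)) := by
      have := hbw (i₀ - 6) (by omega); rw [show i₀ - 6 + 1 = i₀ - 5 by omega] at this; exact this.symm
    rw [hp5] at hadj
    have hne : ω (i₀ - 6) ≠ ω (i₀ - 4) := fun h => by
      have := hinj (show i₀ - 6 ∈ {i | i ≤ n} by simp; omega) (show i₀ - 4 ∈ {i | i ≤ n} by simp; omega) h; omega
    rcases adj_cases hadj with ⟨hz0, hz1⟩ | ⟨hz0, hz1⟩ | hz0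
    · exfalso; apply hne; rw [p4, fs_site_eq_iff]; simp only [pt_apply_zero, pt_apply_one] at hz0 hz1 ⊢; omega
    · rw [fs_site_eq_iff]; simp only [pt_apply_zero, pt_apply_one] at hz0 hz1 ⊢; omega
    · rcases vertical_cases hadj hz0 with ⟨hy, hp⟩ | ⟨hy, hp⟩
      · exfalso; simp only [pt_apply_zero, pt_apply_one] at hz0 hy hp; omega
      · exfalso; apply hX4 (i₀ - 6) (by omega); rw [fs_site_eq_iff]; simp only [pt_apply_zero, pt_apply_one] at hz0 hy ⊢; omega
  -- `i₀ + 3 ≤ n`: otherwise `ω (i₀+2)` is the end `e₀ = (1,0)`, so `xb = 2`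
  have hi₀3n : i₀ + 3 ≤ n := by
    by_contra hlt
    have h2 : i₀ + 2 = n := by omega
    rw [h2, hn'] at hs2
    have e0 := congrFun hs2 0; simp at e0; omega
  -- `ω (i₀+3) = (xb−1, L+2)`: from `(xb−1,L+1)` the vertical bond goes up; left is `ω (i₀−3)`, right is `ω (i₀+1)`
  have s3 : ω (i₀ + 3) = pt (xb - 1) (L + 2) := by
    have hadj : brickWallGraph.Adj (ω (i₀ + 2)) (ω (i₀ + 3)) := hbw (i₀ + 2) (by omega)
    rw [hs2] at hadj
    have hne1 : ω (i₀ + 3) ≠ ω (i₀ + 1) := fun h => by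
      have := hinj (show i₀ + 3 ∈ {i | i ≤ n} by simp; omega) (show i₀ + 1 ∈ {i | i ≤ n} by simp; omega) h; omega
    have hne3 : ω (i₀ + 3) ≠ ω (i₀ - 3) := fun h => by
      have := hinj (show i₀ + 3 ∈ {i | i ≤ n} by simp; omega) (show i₀ - 3 ∈ {i | i ≤ n} by simp; omega) h; omega
    rcases adj_cases hadj with ⟨hz0, hz1⟩ | ⟨hz0, hz1⟩ | hz0
    · exfalso; apply hne1; rw [hs1, fs_site_eq_iff]; simp only [pt_apply_zero, pt_apply_one] at hz0 hz1 ⊢; omega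
    · exfalso; apply hne3; rw [p3, fs_site_eq_iff]; simp only [pt_apply_zero, pt_apply_one] at hz0 hz1 ⊢; omega
    · rcases vertical_cases hadj hz0 with ⟨hy, hp⟩ | ⟨hy, hp⟩
      · rw [fs_site_eq_iff]; simp only [pt_apply_zero, pt_apply_one] at hz0 hy ⊢; omega
      · exfalso; simp only [pt_apply_zero, pt_apply_one] at hz0 hy hp; omega
  have hX5 := botfree5_of_free4 hE (by omega) hpar hx hminH hX4
  have hw : ∀ s, s ≤ 8 → ω (i₀ - 5 + s) = tpath wUb 8 xb L true s := by
    intro s hs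
    interval_cases s
    · exact tpath_eq (by rw [show i₀ - 5 + 0 = i₀ - 5 by omega, hp5]) (by simp [rd, wUb])
    · exact tpath_eq (by rw [show i₀ - 5 + 1 = i₀ - 4 by omega, p4]) (by simp [rd, wUb])
    · exact tpath_eq (by rw [show i₀ - 5 + 2 = i₀ - 3 by omega, p3]) (by simp [rd, wUb])
    · exact tpath_eq (by rw [show i₀ - 5 + 3 = i₀ - 2 by omega, p2]) (by simp [rd, wUb])
    · exact tpath_eq (by rw [show i₀ - 5 + 4 = i₀ - 1 by omega, p1]) (by simp [rd, wUb])
    · exact tpath_eq (by rw [show i₀ - 5 + 5 = i₀ by omega, hv]) (by simp [rd, wUb])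
    · exact tpath_eq (by rw [show i₀ - 5 + 6 = i₀ + 1 by omega, hs1]) (by simp [rd, wUb])
    · exact tpath_eq (by rw [show i₀ - 5 + 7 = i₀ + 2 by omega, hs2]) (by simp [rd, wUb])
    · exact tpath_eq (by rw [show i₀ - 5 + 8 = i₀ + 3 by omega, s3]) (by simp [rd, wUb])
  exact ⟨hi₀3n, spliceOK_Ub hE hpar hx hminH hmaxX hX3 hX4 hX5 hw (by omega), hw⟩

/-- **Floor-slide datum, backward** (`ω (i₀−1) = (xb,L+1)`, `ω (i₀−2) = (xb−1,L+1)`, `ω (i₀+5) = (xb−4,L+1)`): the `8`-window sits at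
`i₀ − 3` and is read backwards. [cite: MadrasSlade1993, §3.2 (proof of Theorem 3.2.3)] -/
theorem stepTwo_data_Ub_bwd (hω : ω ∈ canonEnd n) {i₀ : ℕ} (hi₀2 : 2 ≤ i₀) (hi₀5n : i₀ + 5 ≤ n) (hv : ω i₀ = pt xb L) (hx : 6 ≤ xb)
    (hminH : ∀ i, i ≤ n → L ≤ ω i 1) (hmaxX : ∀ i, i ≤ n → ω i 1 = L → ω i 0 ≤ xb)
    (hX3 : ∀ t, t ≤ n → ω t ≠ pt (xb - 3) L) (hX4 : ∀ t, t ≤ n → ω t ≠ pt (xb - 4) L)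
    (hp1 : ω (i₀ - 1) = pt xb (L + 1)) (hp2 : ω (i₀ - 2) = pt (xb - 1) (L + 1))
    (hs5 : ω (i₀ + 5) = pt (xb - 4) (L + 1)) :
    3 ≤ i₀ ∧ SpliceAddOK n 2 8 ω (i₀ - 3) (tpath offUb 10 xb L false) ∧
      (∀ s, s ≤ 8 → ω (i₀ - 3 + s) = tpath wUb 8 xb L false s) := by
  obtain ⟨hE, hlex⟩ := mem_canonEnd.1 hω
  obtain ⟨⟨h0, -, hbw, hinj⟩, hn'⟩ := mem_endAt_iff.1 hE
  have hpar : (xb + L) % 2 = 0 := by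
    have hvc := vertical_cases (hbw (i₀ - 1) (by omega)) (by rw [show i₀ - 1 + 1 = i₀ by omega, hv, hp1]; simp)
    rw [show i₀ - 1 + 1 = i₀ by omega, hv, hp1] at hvc; simp only [pt_apply_zero, pt_apply_one] at hvc; omega
  -- `ω (i₀+1) = (xb−1, L)`
  have s1 : ω (i₀ + 1) = pt (xb - 1) L := by
    have hadj : brickWallGraph.Adj (ω i₀) (ω (i₀ + 1)) := hbw i₀ (by omega)
    rw [hv] at hadj
    have hne : ω (i₀ + 1) ≠ ω (i₀ - 1) := fun h => by
      have := hinj (show i₀ + 1 ∈ {i | i ≤ n} by simp; omega) (show i₀ - 1 ∈ {i | i ≤ n} by simp; omega) h; omega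
    rcases adj_cases hadj with ⟨hz0, hz1⟩ | ⟨hz0, hz1⟩ | hz0
    · exfalso; have := hmaxX (i₀ + 1) (by omega) (by simp only [pt_apply_one] at hz1; omega)
      simp only [pt_apply_zero] at hz0; omega
    · rw [fs_site_eq_iff]; simp only [pt_apply_zero, pt_apply_one] at hz0 hz1 ⊢; omega
    · rcases vertical_cases hadj hz0 with ⟨hy, hp⟩ | ⟨hy, hp⟩
      · exfalso; apply hne; rw [hp1, fs_site_eq_iff]; simp only [pt_apply_zero, pt_apply_one] at hz0 hy ⊢; omega
      · exfalso; have := hminH (i₀ + 1) (by omega); simp only [pt_apply_one] at hy; omega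
  have s2 : ω (i₀ + 2) = pt (xb - 2) L := bottom_corner_succ hω (by omega) (by omega) hv hminH s1 hp1
  obtain ⟨hi₀3n, s3⟩ := notXb_succ_bwd hE hpar hminH (by omega) s2 s1 hX3
  have s4 : ω (i₀ + 4) = pt (xb - 3) (L + 1) := by
    have hadj : brickWallGraph.Adj (ω (i₀ + 3)) (ω (i₀ + 4)) := hbw (i₀ + 3) (by omega)
    rw [s3] at hadj
    have hne2 : ω (i₀ + 4) ≠ ω (i₀ - 2) := fun h => by
      have := hinj (show i₀ + 4 ∈ {i | i ≤ n} by simp; omega) (show i₀ - 2 ∈ {i | i ≤ n} by simp; omega) h; omega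
    have hne3 : ω (i₀ + 4) ≠ ω (i₀ + 2) := fun h => by
      have := hinj (show i₀ + 4 ∈ {i | i ≤ n} by simp; omega) (show i₀ + 2 ∈ {i | i ≤ n} by simp; omega) h; omega
    rcases adj_cases hadj with ⟨hz0, hz1⟩ | ⟨hz0, hz1⟩ | hz0
    · exfalso; apply hne2; rw [hp2, fs_site_eq_iff]; simp only [pt_apply_zero, pt_apply_one] at hz0 hz1 ⊢; omega
    · rw [fs_site_eq_iff]; simp only [pt_apply_zero, pt_apply_one] at hz0 hz1 ⊢; omega
    · rcases vertical_cases hadj hz0 with ⟨hy, hp⟩ | ⟨hy, hp⟩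
      · exfalso; simp only [pt_apply_zero, pt_apply_one] at hz0 hy hp; omega
      · exfalso; apply hne3; rw [s2, fs_site_eq_iff]; simp only [pt_apply_zero, pt_apply_one] at hz0 hy ⊢; omega
  -- `i₀ ≥ 3`: otherwise `ω (i₀−2)` is the root, `xb = 1`
  have hi₀3 : 3 ≤ i₀ := by
    by_contra hlt
    have h2 : i₀ - 2 = 0 := by omega
    rw [h2, h0] at hp2
    have e0 := congrFun hp2 0; simp at e0; omega
  have p3 : ω (i₀ - 3) = pt (xb - 1) (L + 2) := by
    have hadj : brickWallGraph.Adj (ω (i₀ - 2)) (ω (i₀ - 3)) := by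
      have := hbw (i₀ - 3) (by omega); rw [show i₀ - 3 + 1 = i₀ - 2 by omega] at this; exact this.symm
    rw [hp2] at hadj
    have hne1 : ω (i₀ - 3) ≠ ω (i₀ - 1) := fun h => by
      have := hinj (show i₀ - 3 ∈ {i | i ≤ n} by simp; omega) (show i₀ - 1 ∈ {i | i ≤ n} by simp; omega) h; omega
    have hne3 : ω (i₀ - 3) ≠ ω (i₀ + 3) := fun h => by
      have := hinj (show i₀ - 3 ∈ {i | i ≤ n} by simp; omega) (show i₀ + 3 ∈ {i | i ≤ n} by simp; omega) h; omega
    rcases adj_cases hadj with ⟨hz0, hz1⟩ | ⟨hz0, hz1⟩ | hz0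
    · exfalso; apply hne1; rw [hp1, fs_site_eq_iff]; simp only [pt_apply_zero, pt_apply_one] at hz0 hz1 ⊢; omega
    · exfalso; apply hne3; rw [s3, fs_site_eq_iff]; simp only [pt_apply_zero, pt_apply_one] at hz0 hz1 ⊢; omega
    · rcases vertical_cases hadj hz0 with ⟨hy, hp⟩ | ⟨hy, hp⟩
      · rw [fs_site_eq_iff]; simp only [pt_apply_zero, pt_apply_one] at hz0 hy ⊢; omega
      · exfalso; simp only [pt_apply_zero, pt_apply_one] at hz0 hy hp; omega
  have hX5 := botfree5_of_free4 hE (by omega) hpar hx hminH hX4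
  have hw : ∀ s, s ≤ 8 → ω (i₀ - 3 + s) = tpath wUb 8 xb L false s := by
    intro s hs
    interval_cases s
    · exact tpath_eq (by rw [show i₀ - 3 + 0 = i₀ - 3 by omega, p3]) (by simp [rd, wUb])
    · exact tpath_eq (by rw [show i₀ - 3 + 1 = i₀ - 2 by omega, hp2]) (by simp [rd, wUb])
    · exact tpath_eq (by rw [show i₀ - 3 + 2 = i₀ - 1 by omega, hp1]) (by simp [rd, wUb])
    · exact tpath_eq (by rw [show i₀ - 3 + 3 = i₀ by omega, hv]) (by simp [rd, wUb])
    · exact tpath_eq (by rw [show i₀ - 3 + 4 = i₀ + 1 by omega, s1]) (by simp [rd, wUb])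
    · exact tpath_eq (by rw [show i₀ - 3 + 5 = i₀ + 2 by omega, s2]) (by simp [rd, wUb])
    · exact tpath_eq (by rw [show i₀ - 3 + 6 = i₀ + 3 by omega, s3]) (by simp [rd, wUb])
    · exact tpath_eq (by rw [show i₀ - 3 + 7 = i₀ + 4 by omega, s4]) (by simp [rd, wUb])
    · exact tpath_eq (by rw [show i₀ - 3 + 8 = i₀ + 5 by omega, hs5]) (by simp [rd, wUb])
  exact ⟨hi₀3, spliceOK_Ub hE hpar hx hminH hmaxX hX3 hX4 hX5 hw (by omega), hw⟩

end FloorData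


/-! ### The image: bottom corner, sites, decoding, cross lemmas -/

section FloorImage

variable {xb L : ℤ} {fwd : Bool} {j : ℕ}

/-- **Bottom corner of a floor-slide image**: `(xb − 3, L − 1)`, at table index `5` (time `j + 5` in both orientations).
[cite: MadrasSlade1993, §3.2 (proof of Theorem 3.2.3: an extreme point)] -/
theorem botAt_spliceUb (hminH : ∀ i, i ≤ n → L ≤ ω i 1) (hmaxX : ∀ i, i ≤ n → ω i 1 = L → ω i 0 ≤ xb)
    (hP : SpliceAddOK n 2 8 ω j (tpath offUb 10 xb L fwd)) :
    BotSix (n + 2) (spliceAdd 2 8 ω (tpath offUb 10 xb L fwd) j) (L + (-1)) (xb + (-3)) (j + rd fwd 10 5) :=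
  botAt_spliceAdd hminH hmaxX hP (by norm_num) (by omega) (fun u hu => by
    interval_cases u <;> simp only [offUb] <;> omega) (by norm_num) rfl

/-- **The floor-slide image carries the site `(xb−4, L)`** (table index `1`). [cite: MadrasSlade1993, §3.2 (proof of Theorem 3.2.3)] -/
theorem spliceUb_has_site1 (hP : SpliceAddOK n 2 8 ω j (tpath offUb 10 xb L fwd)) :
    ∃ t, t ≤ n + 2 ∧ spliceAdd 2 8 ω (tpath offUb 10 xb L fwd) j t = pt (xb - 4) L := by
  have hwnd := hP.wnd
  refine ⟨j + rd fwd 10 1, by unfold rd; split_ifs <;> omega, ?_⟩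
  rw [spliceAdd_mid hP.start (rd_le (by norm_num)), tpath]
  have : rd fwd 10 (rd fwd 10 1) = 1 := by unfold rd; split_ifs <;> omega
  rw [this]; simp only [offUb]; exact pt_inj.2 ⟨by ring, by ring⟩

/-- **The floor-slide image avoids `(xb−6, L−1)`** (three steps left of its corner on the new bottom row).
[cite: MadrasSlade1993, §3.2 (proof of Theorem 3.2.3)] -/
theorem spliceUb_free_left3 (hminH : ∀ i, i ≤ n → L ≤ ω i 1) (hP : SpliceAddOK n 2 8 ω j (tpath offUb 10 xb L fwd)) :
    ∀ t, t ≤ n + 2 → spliceAdd 2 8 ω (tpath offUb 10 xb L fwd) j t ≠ pt (xb - 6) (L - 1) := by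
  intro t ht he
  rcases spliceAdd_site_cases hP ht with ⟨a, ha, -, hta⟩ | ⟨s, hs, hts⟩
  · rw [hta] at he; have := hminH a ha; rw [he] at this; simp only [pt_apply_one] at this; omega
  · rw [hts, tpath] at he
    obtain ⟨e1, e2⟩ := pt_inj.1 he
    have hr := rd_le (fwd := fwd) hs
    generalize rd fwd 10 s = u at e1 e2 hr
    interval_cases u <;> simp only [offUb] at e1 e2 <;> omega

/-- Site at time `j + 6`: `(xb−3, L)` forward, `(xb−4, L−1)` backward. [cite: MadrasSlade1993, §3.2 (proof of Theorem 3.2.3)] -/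
theorem spliceUb_at_six (hP : SpliceAddOK n 2 8 ω j (tpath offUb 10 xb L fwd)) :
    (fwd = true → spliceAdd 2 8 ω (tpath offUb 10 xb L fwd) j (j + 6) = pt (xb - 3) L) ∧
    (fwd = false → spliceAdd 2 8 ω (tpath offUb 10 xb L fwd) j (j + 6) = pt (xb - 4) (L - 1)) := by
  constructor <;> (rintro rfl; rw [spliceAdd_mid hP.start (by norm_num)]; simp [tpath, rd, offUb]) <;> ring_nf

/-- Site at time `j + 4`: `(xb−4, L−1)` forward, `(xb−3, L)` backward. [cite: MadrasSlade1993, §3.2] -/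
theorem spliceUb_at_four (hP : SpliceAddOK n 2 8 ω j (tpath offUb 10 xb L fwd)) :
    (fwd = true → spliceAdd 2 8 ω (tpath offUb 10 xb L fwd) j (j + 4) = pt (xb - 4) (L - 1)) ∧
    (fwd = false → spliceAdd 2 8 ω (tpath offUb 10 xb L fwd) j (j + 4) = pt (xb - 3) L) := by
  constructor <;> (rintro rfl; rw [spliceAdd_mid hP.start (by norm_num)]; simp [tpath, rd, offUb]) <;> ring_nf

/-- Two steps past the corner in its own direction (`j + 7` forward, `j + 3` backward) the image is at `(xb−2, L)`: above its bottom
corner the walk turns RIGHT (a down-LEFT leaf). [cite: MadrasSlade1993, §3.2] -/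
theorem spliceUb_turn_right (hP : SpliceAddOK n 2 8 ω j (tpath offUb 10 xb L fwd)) :
    (fwd = true → spliceAdd 2 8 ω (tpath offUb 10 xb L fwd) j (j + 7) = pt (xb - 2) L) ∧
    (fwd = false → spliceAdd 2 8 ω (tpath offUb 10 xb L fwd) j (j + 3) = pt (xb - 2) L) := by
  constructor <;> (rintro rfl; rw [spliceAdd_mid hP.start (by norm_num)]; simp [tpath, rd, offUb]) <;> ring_nf

/-- **Decoding within the floor-slide class.** [cite: MadrasSlade1993, §3.2 (proof of Theorem 3.2.3: "Q can be unambiguously determined")] -/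
theorem spliceUb_decode {ω₁ ω₂ : ℕ → Site 2} {xb₁ L₁ xb₂ L₂ : ℤ} {j₁ j₂ : ℕ} {fwd₁ fwd₂ : Bool}
    (hω₁ : ω₁ ∈ canonEnd n) (hω₂ : ω₂ ∈ canonEnd n)
    (hminH₁ : ∀ i, i ≤ n → L₁ ≤ ω₁ i 1) (hmaxX₁ : ∀ i, i ≤ n → ω₁ i 1 = L₁ → ω₁ i 0 ≤ xb₁)
    (hminH₂ : ∀ i, i ≤ n → L₂ ≤ ω₂ i 1) (hmaxX₂ : ∀ i, i ≤ n → ω₂ i 1 = L₂ → ω₂ i 0 ≤ xb₂)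
    (hP₁ : SpliceAddOK n 2 8 ω₁ j₁ (tpath offUb 10 xb₁ L₁ fwd₁)) (hP₂ : SpliceAddOK n 2 8 ω₂ j₂ (tpath offUb 10 xb₂ L₂ fwd₂))
    (hw₁ : ∀ s, s ≤ 8 → ω₁ (j₁ + s) = tpath wUb 8 xb₁ L₁ fwd₁ s) (hw₂ : ∀ s, s ≤ 8 → ω₂ (j₂ + s) = tpath wUb 8 xb₂ L₂ fwd₂ s)
    (h : spliceAdd 2 8 ω₁ (tpath offUb 10 xb₁ L₁ fwd₁) j₁ = spliceAdd 2 8 ω₂ (tpath offUb 10 xb₂ L₂ fwd₂) j₂) : ω₁ = ω₂ := by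
  obtain ⟨hE₁, -⟩ := mem_canonEnd.1 hω₁
  obtain ⟨hE₂, -⟩ := mem_canonEnd.1 hω₂
  have hW : spliceAdd 2 8 ω₁ (tpath offUb 10 xb₁ L₁ fwd₁) j₁ ∈ endAt (n + 2) (Pi.single 0 1 : Site 2) := spliceAdd_mem hE₁ hP₁
  have hinj := (mem_endAt_iff.1 hW).1.2.2.2
  have T₁ := botAt_spliceUb hminH₁ hmaxX₁ hP₁
  have T₂ := botAt_spliceUb hminH₂ hmaxX₂ hP₂
  rw [← h] at T₂
  obtain ⟨eL, ex, eτ⟩ := botAt_unique hinj T₁ T₂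
  rw [rd_ten_five, rd_ten_five] at eτ
  have eL' : L₁ = L₂ := by omega
  have ex' : xb₁ = xb₂ := by omega
  have ej : j₁ = j₂ := by omega
  subst eL' ex' ej
  have A₁ := spliceUb_at_six hP₁
  have A₂ := spliceUb_at_six hP₂
  rw [← h] at A₂
  cases fwd₁ <;> cases fwd₂
  · exact eq_of_spliceAdd_eq hE₁ hE₂ hP₁ hP₂ hw₁ hw₂ h
  · exfalso; have e := (A₁.2 rfl).symm.trans (A₂.1 rfl); have := (pt_inj.1 e).2; omega
  · exfalso; have e := (A₁.1 rfl).symm.trans (A₂.2 rfl); have := (pt_inj.1 e).2; omega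
  · exact eq_of_spliceAdd_eq hE₁ hE₂ hP₁ hP₂ hw₁ hw₂ h

/-- **A floor-slide image is not in the bottom-leaf class** (above its bottom corner it turns right; the other neighbour of the corner is on
the new bottom row). [cite: MadrasSlade1993, §3.2 (proof of Theorem 3.2.3)] -/
theorem not_isBotLeaf_spliceUb (hω : ω ∈ canonEnd n)
    (hminH : ∀ i, i ≤ n → L ≤ ω i 1) (hmaxX : ∀ i, i ≤ n → ω i 1 = L → ω i 0 ≤ xb)
    (hP : SpliceAddOK n 2 8 ω j (tpath offUb 10 xb L fwd)) : ¬ IsBotLeaf (n + 2) (spliceAdd 2 8 ω (tpath offUb 10 xb L fwd) j) := by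
  intro hleaf
  obtain ⟨hE, -⟩ := mem_canonEnd.1 hω
  obtain ⟨L', x', τ, T', -, hpat⟩ := botSix_of_isBotLeaf hleaf
  have hW := spliceAdd_mem hE hP
  have hinj := (mem_endAt_iff.1 hW).1.2.2.2
  obtain ⟨eL, ex, eτ⟩ := botAt_unique hinj (botAt_spliceUb hminH hmaxX hP) T'
  rw [rd_ten_five] at eτ
  have A6 := spliceUb_at_six hP
  have A4 := spliceUb_at_four hP
  have AR := spliceUb_turn_right hP
  cases fwd
  · rcases hpat with ⟨-, h1, -⟩ | ⟨-, -, h2⟩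
    · rw [← eτ, A6.2 rfl] at h1; have := (pt_inj.1 h1).2; omega
    · rw [← eτ, show j + 5 - 2 = j + 3 by omega, AR.2 rfl] at h2; have := (pt_inj.1 h2).1; omega
  · rcases hpat with ⟨-, -, h2⟩ | ⟨-, h1, -⟩
    · rw [← eτ, show j + 5 + 2 = j + 7 by omega, AR.1 rfl] at h2; have := (pt_inj.1 h2).1; omega
    · rw [← eτ, show j + 5 - 1 = j + 4 by omega, A4.1 rfl] at h1; have := (pt_inj.1 h1).2; omega

/-- **A case-X♭ image avoids the site `(xb−2, L)`** above its bottom hexagon (it became an interior vertex).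
[cite: MadrasSlade1993, §3.2 (proof of Theorem 3.2.3)] -/
theorem spliceXb_free_over {xb L : ℤ} {fwd : Bool} {j : ℕ} (hω : ω ∈ endAt n (Pi.single 0 1 : Site 2))
    (hP : SpliceAddOK n 2 2 ω j (tpath offXb 4 xb L fwd)) (hw : ∀ s, s ≤ 2 → ω (j + s) = tpath w6A 2 xb L fwd s) :
    ∀ t, t ≤ n + 2 → spliceAdd 2 2 ω (tpath offXb 4 xb L fwd) j t ≠ pt (xb - 2) L := by
  have hinj := (mem_endAt_iff.1 hω).1.2.2.2
  have hwnd := hP.wnd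
  intro t ht he
  rcases spliceAdd_site_cases hP ht with ⟨a, ha, hao, hta⟩ | ⟨s, hs, hts⟩
  · have e1 : ω (j + 1) = pt (xb - 2) L := by
      rw [hw 1 (by norm_num), tpath]; cases fwd <;> simp [rd, w6A] <;> ring_nf
    rw [hta] at he
    have := hinj (show a ∈ {i | i ≤ n} by simpa using ha) (show j + 1 ∈ {i | i ≤ n} by simp; omega) (by rw [he, e1])
    omega
  · rw [hts, tpath] at he
    obtain ⟨e1, e2⟩ := pt_inj.1 he
    have hr := rd_le (fwd := fwd) hs
    generalize rd fwd 4 s = u at e1 e2 hr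
    interval_cases u <;> simp only [offXb] at e1 e2 <;> omega

/-- **A floor-slide image is not a bottom image of the two-corner map**: against a case-X♭ image, the site `(xb−4, L)` of the slide image
is the site above the X♭-image's bottom hexagon, which that image avoids; against a floor image, the floor carries the bottom-row site three
steps left of its corner, which the slide image avoids. [cite: MadrasSlade1993, §3.2 (proof of Theorem 3.2.3)] -/
theorem spliceUb_ne_bottom {ω₁ ω₂ : ℕ → Site 2} {xb₁ L₁ : ℤ} {j₁ : ℕ} {fwd₁ : Bool} {L₂ xb₂ : ℤ} {j₂ k₂ : ℕ} {fwd₂ : Bool}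
    (hω₁ : ω₁ ∈ canonEnd n) (hω₂ : ω₂ ∈ canonEnd n)
    (hminH₁ : ∀ i, i ≤ n → L₁ ≤ ω₁ i 1) (hmaxX₁ : ∀ i, i ≤ n → ω₁ i 1 = L₁ → ω₁ i 0 ≤ xb₁)
    (hminH₂ : ∀ i, i ≤ n → L₂ ≤ ω₂ i 1) (hmaxX₂ : ∀ i, i ≤ n → ω₂ i 1 = L₂ → ω₂ i 0 ≤ xb₂)
    (hP₁ : SpliceAddOK n 2 8 ω₁ j₁ (tpath offUb 10 xb₁ L₁ fwd₁))
    (hd₂ : BottomDatum n ω₂ (spliceAdd 2 8 ω₁ (tpath offUb 10 xb₁ L₁ fwd₁) j₁) L₂ xb₂ j₂ k₂ fwd₂) : False := by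
  obtain ⟨hE₁, -⟩ := mem_canonEnd.1 hω₁
  obtain ⟨hE₂, -⟩ := mem_canonEnd.1 hω₂
  have hW := spliceAdd_mem hE₁ hP₁
  have hinj := (mem_endAt_iff.1 hW).1.2.2.2
  have T₁ := botAt_spliceUb hminH₁ hmaxX₁ hP₁
  rcases hd₂ with ⟨-, hP₂, hw₂, -, -, hWeq⟩ | ⟨hk, -, hP₂, -, hpre, hpost, hWeq⟩
  · have T₂ := botAt_spliceXb hminH₂ hmaxX₂ hP₂
    rw [← hWeq] at T₂
    obtain ⟨eL, ex, -⟩ := botAt_unique hinj T₁ T₂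
    obtain ⟨t, ht, e⟩ := spliceUb_has_site1 hP₁
    rw [hWeq] at e
    exact spliceXb_free_over hE₂ hP₂ hw₂ t ht (by rw [e]; exact pt_inj.2 ⟨by omega, by omega⟩)
  · have T₂ := botAt_spliceYsb hminH₂ hmaxX₂ hP₂
    rw [← hWeq] at T₂
    obtain ⟨eL, ex, -⟩ := botAt_unique hinj T₁ T₂
    have hfr := (mem_endAt_iff.1 hE₂).1.2.1
    have hwnd := hP₂.wnd
    obtain ⟨t, ht, e⟩ : ∃ t, t ≤ n + 2 ∧
        spliceAdd 2 (2 * k₂) ω₂ (tpath (offYsb k₂) (2 * k₂ + 2) xb₂ L₂ fwd₂) j₂ t = pt (xb₂ + 2 * k₂ - 3) L₂ := by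
      cases fwd₂
      · rcases Nat.lt_or_ge k₂ 2 with hk1 | hk2
        · obtain ⟨q1, -⟩ := hpost rfl
          by_cases hb : j₂ + 2 * k₂ + 1 ≤ n
          · refine ⟨j₂ + 2 * k₂ + 3, by omega, ?_⟩
            rw [spliceAdd_of_ge hP₂.finish (by omega), show j₂ + 2 * k₂ + 3 - 2 = j₂ + 2 * k₂ + 1 by omega, q1]
            exact pt_inj.2 ⟨by omega, rfl⟩
          · refine ⟨n + 2, le_rfl, ?_⟩
            rw [spliceAdd_of_ge hP₂.finish (by omega), show n + 2 - 2 = n by omega, ← hfr (j₂ + 2 * k₂ + 1) (by omega), q1]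
            exact pt_inj.2 ⟨by omega, rfl⟩
        · exact ⟨j₂ + (2 + 3), by omega, by exact_mod_cast (spliceYsb_sites_bwd hP₂).1 3 (by omega)⟩
      · rcases Nat.lt_or_ge k₂ 2 with hk1 | hk2
        · obtain ⟨hj3, q1, -, -⟩ := hpre rfl
          refine ⟨j₂ - 1, by omega, ?_⟩
          rw [spliceAdd_of_le (by omega), q1]
          exact pt_inj.2 ⟨by omega, rfl⟩
        · have e := (spliceYsb_sites_fwd hP₂).1 (2 * k₂ - 3) (by omega)
          refine ⟨j₂ + (2 * k₂ - 3), by omega, ?_⟩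
          rw [e]; exact pt_inj.2 ⟨by omega, rfl⟩
    rw [← hWeq] at e
    exact spliceUb_free_left3 hminH₁ hP₁ t ht (by rw [e]; exact pt_inj.2 ⟨by omega, by omega⟩)

end FloorImage


/-! ### PART II — a top leaf survives a low surgery -/

section LowSplice

/-- **A top leaf survives a low `+2` surgery**: if the INTERIOR window sites and the interior new sites of an admissible `+2` splice (window
length `≥ 2`) all have height `≤ B` with `B + 2 ≤ H`, a top-leaf polygon has a top-leaf image.  (The window endpoints are fixed points of the
splice and may belong to the leaf block.) [cite: MadrasSlade1993, §3.2 (proof of Theorem 3.2.3)] -/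
theorem isTopLeaf_spliceAdd_low {Lw j : ℕ} {π : ℕ → Site 2} {B : ℤ} (hP : SpliceAddOK n 2 Lw ω j π) (hLw : 2 ≤ Lw)
    (hπ : ∀ s, 0 < s → s < Lw + 2 → π s 1 ≤ B) (hwin : ∀ s, 0 < s → s < Lw → ω (j + s) 1 ≤ B)
    (hleaf : IsTopLeaf n ω) (hB : ∀ H : ℤ, (∀ i, i ≤ n → ω i 1 ≤ H) → B + 2 ≤ H) :
    IsTopLeaf (n + 2) (spliceAdd 2 Lw ω π j) := by
  obtain ⟨H, xm, t₀, ht₀n, hv, hx2, hmaxH, hmaxX, hX, hpat⟩ := hleaf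
  have hBH : B + 2 ≤ H := hB H hmaxH
  have hwnd := hP.wnd
  -- every image site is an old site, or an interior new site (height `≤ B`)
  have site : ∀ i, i ≤ n + 2 → (∃ a, a ≤ n ∧ spliceAdd 2 Lw ω π j i = ω a) ∨ spliceAdd 2 Lw ω π j i 1 ≤ B := by
    intro i hi
    rcases spliceAdd_site_cases hP hi with ⟨a, ha, -, e⟩ | ⟨s, hs, e⟩
    · exact Or.inl ⟨a, ha, e⟩
    · rcases Nat.eq_zero_or_pos s with rfl | hs0
      · exact Or.inl ⟨j, by omega, by rw [e, hP.start]⟩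
      · rcases eq_or_lt_of_le hs with hsL | hsL
        · exact Or.inl ⟨j + Lw, by omega, by rw [e, hsL, hP.finish]⟩
        · exact Or.inr (by rw [e]; exact hπ s hs0 hsL)
  have hmaxH' : ∀ i, i ≤ n + 2 → spliceAdd 2 Lw ω π j i 1 ≤ H := by
    intro i hi
    rcases site i hi with ⟨a, ha, e⟩ | h
    · rw [e]; exact hmaxH a ha
    · omega
  have hmaxX' : ∀ i, i ≤ n + 2 → spliceAdd 2 Lw ω π j i 1 = H → spliceAdd 2 Lw ω π j i 0 ≤ xm := by
    intro i hi hiH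
    rcases site i hi with ⟨a, ha, e⟩ | h
    · rw [e] at hiH ⊢; exact hmaxX a ha hiH
    · omega
  have hX' : ∀ t, t ≤ n + 2 → spliceAdd 2 Lw ω π j t ≠ pt (xm - 3) H := by
    intro t ht e
    rcases site t ht with ⟨a, ha, e'⟩ | h
    · exact hX a ha (e'.symm.trans e)
    · rw [e, pt_apply_one] at h; omega
  -- the leaf block (heights `≥ H − 1`) avoids the OPEN window
  have notwin : ∀ t, t ≤ n → H - 1 ≤ ω t 1 → t ≤ j ∨ j + Lw ≤ t := by
    intro t ht hth
    by_contra hcon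
    push Not at hcon
    obtain ⟨s, rfl⟩ : ∃ s, t = j + s := ⟨t - j, by omega⟩
    have := hwin s (by omega) (by omega); omega
  have hvH : H - 1 ≤ ω t₀ 1 := by rw [hv]; simp
  rcases hpat with ⟨ht2, h1, h2⟩ | ⟨ht2, h1, h2⟩
  · have g1 : H - 1 ≤ ω (t₀ + 1) 1 := by rw [h1]; simp
    have g2 : H - 1 ≤ ω (t₀ + 2) 1 := by rw [h2]; simp
    have hb0 := notwin t₀ (by omega) hvH
    have hb1 := notwin (t₀ + 1) (by omega) g1
    have hb2 := notwin (t₀ + 2) (by omega) g2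
    rcases hb2 with hle | hge
    · refine ⟨H, xm, t₀, by omega, ?_, hx2, hmaxH', hmaxX', hX', Or.inl ⟨by omega, ?_, ?_⟩⟩
      · rw [spliceAdd_of_le (by omega), hv]
      · rw [spliceAdd_of_le (by omega), h1]
      · rw [spliceAdd_of_le hle, h2]
    · have ht0 : j + Lw ≤ t₀ := by omega
      refine ⟨H, xm, t₀ + 2, by omega, ?_, hx2, hmaxH', hmaxX', hX', Or.inl ⟨by omega, ?_, ?_⟩⟩
      · rw [spliceAdd_of_ge hP.finish (by omega), show t₀ + 2 - 2 = t₀ by omega, hv]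
      · rw [spliceAdd_of_ge hP.finish (by omega), show t₀ + 2 + 1 - 2 = t₀ + 1 by omega, h1]
      · rw [spliceAdd_of_ge hP.finish (by omega), show t₀ + 2 + 2 - 2 = t₀ + 2 by omega, h2]
  · have g1 : H - 1 ≤ ω (t₀ - 1) 1 := by rw [h1]; simp
    have g2 : H - 1 ≤ ω (t₀ - 2) 1 := by rw [h2]; simp
    have hb0 := notwin t₀ (by omega) hvH
    have hb1 := notwin (t₀ - 1) (by omega) g1
    have hb2 := notwin (t₀ - 2) (by omega) g2
    rcases hb0 with hle | hge
    · refine ⟨H, xm, t₀, by omega, ?_, hx2, hmaxH', hmaxX', hX', Or.inr ⟨ht2, ?_, ?_⟩⟩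
      · rw [spliceAdd_of_le hle, hv]
      · rw [spliceAdd_of_le (by omega), h1]
      · rw [spliceAdd_of_le (by omega), h2]
    · have ht2j : j + Lw ≤ t₀ - 2 := by omega
      refine ⟨H, xm, t₀ + 2, by omega, ?_, hx2, hmaxH', hmaxX', hX', Or.inr ⟨by omega, ?_, ?_⟩⟩
      · rw [spliceAdd_of_ge hP.finish (by omega), show t₀ + 2 - 2 = t₀ by omega, hv]
      · rw [spliceAdd_of_ge hP.finish (by omega), show t₀ + 2 - 1 - 2 = t₀ - 1 by omega, h1]
      · rw [spliceAdd_of_ge hP.finish (by omega), show t₀ + 2 - 2 - 2 = t₀ - 2 by omega, h2]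

end LowSplice


/-! ### PART III — the class, the datum, and the floor-slot injection -/

section FloorSlot

/-- **The floor-slide class**: a bottom corner `(xb, L) = ω i₀` of the bottom-LEAF class (`(xb−3,L)` off `ω`; above the corner the walk
steps up and then LEFT) whose support run is long (`ω (i₀∓5) = (xb−4, L+1)`), with `(xb−4, L)` off `ω`, `xb ≥ 6` (root-safety), and a
depth witness (a site of height `≥ L + 3`: the polygon has at least three rows — automatic for a top-leaf ∧ bottom-leaf polygon, recorded
for the top-leaf transfer). [cite: MadrasSlade1993, §3.2 (proof of Theorem 3.2.3: surgery at an extreme point)] -/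
def IsFloorSlide (n : ℕ) (ω : ℕ → Site 2) : Prop :=
  ∃ (L xb : ℤ) (i₀ : ℕ), i₀ + 1 ≤ n ∧ ω i₀ = pt xb L ∧ 6 ≤ xb ∧
    (∀ i, i ≤ n → L ≤ ω i 1) ∧ (∀ i, i ≤ n → ω i 1 = L → ω i 0 ≤ xb) ∧
    (∀ t, t ≤ n → ω t ≠ pt (xb - 3) L) ∧ (∀ t, t ≤ n → ω t ≠ pt (xb - 4) L) ∧ (∃ i, i ≤ n ∧ L + 3 ≤ ω i 1) ∧
    ((i₀ + 2 ≤ n ∧ ω (i₀ + 1) = pt xb (L + 1) ∧ ω (i₀ + 2) = pt (xb - 1) (L + 1) ∧ 5 ≤ i₀ ∧ ω (i₀ - 5) = pt (xb - 4) (L + 1)) ∨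
      (2 ≤ i₀ ∧ ω (i₀ - 1) = pt xb (L + 1) ∧ ω (i₀ - 2) = pt (xb - 1) (L + 1) ∧ i₀ + 5 ≤ n ∧ ω (i₀ + 5) = pt (xb - 4) (L + 1)))

/-- A polygon of the floor-slide class is in the bottom-leaf class. [cite: MadrasSlade1993, §3.2 (proof of Theorem 3.2.3)] -/
theorem isBotLeaf_of_isFloorSlide (h : IsFloorSlide n ω) : IsBotLeaf n ω := by
  obtain ⟨L, xb, i₀, hi₀n, hv, hx6, hminH, hmaxX, hX3, -, -, hpat⟩ := h
  rcases hpat with ⟨h2n, h1, h2, -, -⟩ | ⟨h2, h1, h2', -, -⟩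
  · exact ⟨L, xb, i₀, hi₀n, hv, by omega, hminH, hmaxX, hX3, Or.inl ⟨h2n, h1, h2⟩⟩
  · exact ⟨L, xb, i₀, hi₀n, hv, by omega, hminH, hmaxX, hX3, Or.inr ⟨h2, h1, h2'⟩⟩

/-- The decoding datum of a floor-slide image. [cite: MadrasSlade1993, §3.2 (proof of Theorem 3.2.3)] -/
def FloorSlideDatum (n : ℕ) (ω W : ℕ → Site 2) (L xb : ℤ) (j : ℕ) (fwd : Bool) : Prop :=
  SpliceAddOK n 2 8 ω j (tpath offUb 10 xb L fwd) ∧ (∀ s, s ≤ 8 → ω (j + s) = tpath wUb 8 xb L fwd s) ∧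
    W = spliceAdd 2 8 ω (tpath offUb 10 xb L fwd) j

/-- **An image with its decoding datum** for every polygon of the floor-slide class (and the depth witness of the class).
[cite: MadrasSlade1993, §3.2 (proof of Theorem 3.2.3)] -/
theorem exists_floorSlide_image (hω : ω ∈ canonEnd n) (hm : IsFloorSlide n ω) :
    ∃ W : ℕ → Site 2, W ∈ canonEnd (n + 2) ∧ ∃ (L xb : ℤ) (j : ℕ) (fwd : Bool),
      (∀ i, i ≤ n → L ≤ ω i 1) ∧ (∀ i, i ≤ n → ω i 1 = L → ω i 0 ≤ xb) ∧ (∃ i, i ≤ n ∧ L + 3 ≤ ω i 1) ∧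
        FloorSlideDatum n ω W L xb j fwd := by
  obtain ⟨L, xb, i₀, hi₀n, hv, hx6, hminH, hmaxX, hX3, hX4, hdepth, hpat⟩ := hm
  rcases hpat with ⟨h2n, h1, h2, hi₀5, h5⟩ | ⟨hi₀2, h1, h2, h5n, h5⟩
  · obtain ⟨-, hP, hw⟩ := stepTwo_data_Ub_fwd hω h2n hv hx6 hminH hmaxX hX3 hX4 h1 h2 hi₀5 h5
    exact ⟨_, spliceAdd_mem_canonEnd hω hP, L, xb, i₀ - 5, true, hminH, hmaxX, hdepth, hP, hw, rfl⟩
  · obtain ⟨-, hP, hw⟩ := stepTwo_data_Ub_bwd hω hi₀2 h5n hv hx6 hminH hmaxX hX3 hX4 h1 h2 h5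
    exact ⟨_, spliceAdd_mem_canonEnd hω hP, L, xb, i₀ - 3, false, hminH, hmaxX, hdepth, hP, hw, rfl⟩

/-- **Decoding of floor-slide images is datum-free.** [cite: MadrasSlade1993, §3.2 (proof of Theorem 3.2.3: "Q can be unambiguously determined")] -/
theorem eq_of_floorSlide_image_eq {ω₁ ω₂ W : ℕ → Site 2} (hω₁ : ω₁ ∈ canonEnd n) (hω₂ : ω₂ ∈ canonEnd n)
    {L₁ xb₁ : ℤ} {j₁ : ℕ} {fwd₁ : Bool} {L₂ xb₂ : ℤ} {j₂ : ℕ} {fwd₂ : Bool}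
    (hminH₁ : ∀ i, i ≤ n → L₁ ≤ ω₁ i 1) (hmaxX₁ : ∀ i, i ≤ n → ω₁ i 1 = L₁ → ω₁ i 0 ≤ xb₁)
    (hminH₂ : ∀ i, i ≤ n → L₂ ≤ ω₂ i 1) (hmaxX₂ : ∀ i, i ≤ n → ω₂ i 1 = L₂ → ω₂ i 0 ≤ xb₂)
    (h₁ : FloorSlideDatum n ω₁ W L₁ xb₁ j₁ fwd₁) (h₂ : FloorSlideDatum n ω₂ W L₂ xb₂ j₂ fwd₂) : ω₁ = ω₂ := by
  obtain ⟨hP₁, hw₁, rfl⟩ := h₁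
  obtain ⟨hP₂, hw₂, h⟩ := h₂
  exact spliceUb_decode hω₁ hω₂ hminH₁ hmaxX₁ hminH₂ hmaxX₂ hP₁ hP₂ hw₁ hw₂ h

/-- **A floor-slide image of a top-leaf polygon is a top leaf**: the interior window sites and new sites have height `≤ L + 1 ≤ H − 2`.
[cite: MadrasSlade1993, §3.2 (proof of Theorem 3.2.3)] -/
theorem isTopLeaf_of_floorSlideDatum {W : ℕ → Site 2} {L xb : ℤ} {j : ℕ} {fwd : Bool}
    (hd : FloorSlideDatum n ω W L xb j fwd) (hdepth : ∃ i, i ≤ n ∧ L + 3 ≤ ω i 1) (hleaf : IsTopLeaf n ω) :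
    IsTopLeaf (n + 2) W := by
  obtain ⟨hP, hw, rfl⟩ := hd
  obtain ⟨t, ht, hth⟩ := hdepth
  refine isTopLeaf_spliceAdd_low (B := L + 1) hP (by norm_num) (fun s hs0 hs1 => ?_) (fun s hs0 hs1 => ?_) hleaf (fun H hH => ?_)
  · rw [tpath, pt_apply_one]
    have hr : 0 < rd fwd 10 s ∧ rd fwd 10 s < 10 := by unfold rd; split_ifs <;> omega
    generalize rd fwd 10 s = u at hr
    obtain ⟨hr0, hr1⟩ := hr
    interval_cases u <;> simp [offUb]
  · rw [hw s (by omega), tpath, pt_apply_one]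
    have hr : 0 < rd fwd 8 s ∧ rd fwd 8 s < 8 := by unfold rd; split_ifs <;> omega
    generalize rd fwd 8 s = u at hr
    obtain ⟨hr0, hr1⟩ := hr
    interval_cases u <;> simp [wUb]
  · have := hH t ht; omega

/-- **The class served by the floor slot on top of the two corners**: the two-corner class, or floor-slide ∧ top-leaf.
[cite: MadrasSlade1993, §3.2 (proof of Theorem 3.2.3)] -/
def IsStepTwoFloorSlot (n : ℕ) (ω : ℕ → Site 2) : Prop := IsStepTwoTwoCorner n ω ∨ (IsFloorSlide n ω ∧ IsTopLeaf n ω)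

/-- **★ The step two holds on the floor-slot class**: the canonical rooted `(n+1)`-gons (`n ≥ 5`) of class
X ∪ Y⋆ ∪ (leaf ∩ bottom-served) ∪ (floor-slide ∩ top-leaf) inject into the canonical rooted `(n+3)`-gons.  The three kinds of images are
pairwise distinct: top images are not top-leaf; bottom images are top-leaf and carry a `BottomDatum`; floor-slide images are top-leaf and
carry no `BottomDatum` (`spliceUb_ne_bottom`). [cite: MadrasSlade1993, §3.2, Theorem 3.2.3 / (3.2.3) (the `ℤ^d` statement being transplanted)] -/
theorem card_filter_isStepTwoFloorSlot_le [DecidablePred (IsStepTwoFloorSlot n)] (hn : 5 ≤ n) :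
    #((canonEnd n).filter (IsStepTwoFloorSlot n)) ≤ #(canonEnd (n + 2)) := by
  classical
  let P1 : (ℕ → Site 2) → Prop := fun ω => ω ∈ canonEnd n ∧ IsStepTwoRoof n ω
  let P2 : (ℕ → Site 2) → Prop := fun ω => ω ∈ canonEnd n ∧ IsTopLeaf n ω ∧ IsStepTwoBottom n ω
  let P3 : (ℕ → Site 2) → Prop := fun ω => ω ∈ canonEnd n ∧ IsFloorSlide n ω ∧ IsTopLeaf n ω
  let E : (ℕ → Site 2) → (ℕ → Site 2) := fun ω =>
    if h : P1 ω then Classical.choose (exists_stepTwoRoof_image h.1 hn h.2)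
    else if h' : P2 ω then Classical.choose (exists_stepTwoBottom_image h'.1 hn h'.2.2)
    else if h'' : P3 ω then Classical.choose (exists_floorSlide_image h''.1 h''.2.1)
    else ω
  have hE1 : ∀ ω (h : P1 ω), E ω = Classical.choose (exists_stepTwoRoof_image h.1 hn h.2) := fun ω h => dif_pos h
  have hE2 : ∀ ω, ¬ P1 ω → ∀ h' : P2 ω, E ω = Classical.choose (exists_stepTwoBottom_image h'.1 hn h'.2.2) := by
    intro ω h1 h'
    show (if h : P1 ω then _ else _) = _
    rw [dif_neg h1, dif_pos h']
  have hE3 : ∀ ω, ¬ P1 ω → ¬ P2 ω → ∀ h'' : P3 ω, E ω = Classical.choose (exists_floorSlide_image h''.1 h''.2.1) := by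
    intro ω h1 h2 h''
    show (if h : P1 ω then _ else _) = _
    rw [dif_neg h1, dif_neg h2, dif_pos h'']
  have himgR : ∀ ω (h : P1 ω), E ω ∈ canonEnd (n + 2) ∧ ¬ IsTopLeaf (n + 2) (E ω) ∧
      ∃ (H xm : ℤ) (j k : ℕ) (fwd : Bool), (∀ i, i ≤ n → ω i 1 ≤ H) ∧ (∀ i, i ≤ n → ω i 1 = H → ω i 0 ≤ xm) ∧
        RoofDatum n ω (E ω) H xm j k fwd := by
    intro ω h
    rw [hE1 ω h]
    obtain ⟨hW, H, xm, j, k, fwd, hmaxH, hmaxX, hd⟩ := Classical.choose_spec (exists_stepTwoRoof_image h.1 hn h.2)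
    exact ⟨hW, not_isTopLeaf_of_roofDatum h.1 (by omega) hmaxH hmaxX hd, H, xm, j, k, fwd, hmaxH, hmaxX, hd⟩
  have himgB : ∀ ω, ¬ P1 ω → ∀ h' : P2 ω, E ω ∈ canonEnd (n + 2) ∧ IsTopLeaf (n + 2) (E ω) ∧
      ∃ (L xb : ℤ) (j k : ℕ) (fwd : Bool), (∀ i, i ≤ n → L ≤ ω i 1) ∧ (∀ i, i ≤ n → ω i 1 = L → ω i 0 ≤ xb) ∧
        BottomDatum n ω (E ω) L xb j k fwd := by
    intro ω h1 h'
    rw [hE2 ω h1 h']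
    obtain ⟨hW, L, xb, j, k, fwd, hminH, hmaxX, hd⟩ :=
      Classical.choose_spec (exists_stepTwoBottom_image h'.1 hn h'.2.2)
    exact ⟨hW, isTopLeaf_of_bottomDatum h'.1 hd h'.2.1, L, xb, j, k, fwd, hminH, hmaxX, hd⟩
  have himgF : ∀ ω, ¬ P1 ω → ¬ P2 ω → ∀ h'' : P3 ω, E ω ∈ canonEnd (n + 2) ∧ IsTopLeaf (n + 2) (E ω) ∧
      ∃ (L xb : ℤ) (j : ℕ) (fwd : Bool), (∀ i, i ≤ n → L ≤ ω i 1) ∧ (∀ i, i ≤ n → ω i 1 = L → ω i 0 ≤ xb) ∧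
        FloorSlideDatum n ω (E ω) L xb j fwd := by
    intro ω h1 h2 h''
    rw [hE3 ω h1 h2 h'']
    obtain ⟨hW, L, xb, j, fwd, hminH, hmaxX, hdepth, hd⟩ := Classical.choose_spec (exists_floorSlide_image h''.1 h''.2.1)
    exact ⟨hW, isTopLeaf_of_floorSlideDatum hd hdepth h''.2.2, L, xb, j, fwd, hminH, hmaxX, hd⟩
  have hbranch : ∀ ω, ω ∈ canonEnd n → IsStepTwoFloorSlot n ω → P1 ω ∨ (¬ P1 ω ∧ P2 ω) ∨ (¬ P1 ω ∧ ¬ P2 ω ∧ P3 ω) := by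
    intro ω hω hc
    by_cases h1 : P1 ω
    · exact Or.inl h1
    by_cases h2 : P2 ω
    · exact Or.inr (Or.inl ⟨h1, h2⟩)
    refine Or.inr (Or.inr ⟨h1, h2, hω, ?_⟩)
    rcases hc with (hR | ⟨hl, hb⟩) | hs
    · exact absurd ⟨hω, hR⟩ h1
    · exact absurd ⟨hω, hl, hb⟩ h2
    · exact hs
  refine Finset.card_le_card_of_injOn E (fun ω hω => ?_) (fun ω₁ hω₁ ω₂ hω₂ heq => ?_)
  · rw [Finset.mem_coe, Finset.mem_filter] at hω
    rw [Finset.mem_coe]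
    rcases hbranch ω hω.1 hω.2 with h1 | ⟨h1, h2⟩ | ⟨h1, h2, h3⟩
    · exact (himgR ω h1).1
    · exact (himgB ω h1 h2).1
    · exact (himgF ω h1 h2 h3).1
  · rw [Finset.mem_coe, Finset.mem_filter] at hω₁ hω₂
    rcases hbranch ω₁ hω₁.1 hω₁.2 with a1 | ⟨a1, a2⟩ | ⟨a1, a2, a3⟩ <;>
      rcases hbranch ω₂ hω₂.1 hω₂.2 with b1 | ⟨b1, b2⟩ | ⟨b1, b2, b3⟩
    · obtain ⟨-, -, H₁, xm₁, j₁, k₁, fwd₁, hmaxH₁, hmaxX₁, h₁⟩ := himgR ω₁ a1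
      obtain ⟨-, -, H₂, xm₂, j₂, k₂, fwd₂, hmaxH₂, hmaxX₂, h₂⟩ := himgR ω₂ b1
      rw [heq] at h₁
      exact eq_of_stepTwoRoof_image_eq hω₁.1 hω₂.1 hmaxH₁ hmaxX₁ hmaxH₂ hmaxX₂ h₁ h₂
    · exfalso
      obtain ⟨-, hnl, -⟩ := himgR ω₁ a1
      obtain ⟨-, hl, -⟩ := himgB ω₂ b1 b2
      rw [heq] at hnl; exact hnl hl
    · exfalso
      obtain ⟨-, hnl, -⟩ := himgR ω₁ a1
      obtain ⟨-, hl, -⟩ := himgF ω₂ b1 b2 b3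
      rw [heq] at hnl; exact hnl hl
    · exfalso
      obtain ⟨-, hnl, -⟩ := himgR ω₂ b1
      obtain ⟨-, hl, -⟩ := himgB ω₁ a1 a2
      rw [← heq] at hnl; exact hnl hl
    · obtain ⟨-, -, L₁, xb₁, j₁, k₁, fwd₁, hminH₁, hmaxX₁, h₁⟩ := himgB ω₁ a1 a2
      obtain ⟨-, -, L₂, xb₂, j₂, k₂, fwd₂, hminH₂, hmaxX₂, h₂⟩ := himgB ω₂ b1 b2
      rw [heq] at h₁
      exact eq_of_stepTwoBottom_image_eq hω₁.1 hω₂.1 hminH₁ hmaxX₁ hminH₂ hmaxX₂ h₁ h₂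
    · exfalso
      obtain ⟨-, -, L₁, xb₁, j₁, k₁, fwd₁, hminH₁, hmaxX₁, h₁⟩ := himgB ω₁ a1 a2
      obtain ⟨-, -, L₂, xb₂, j₂, fwd₂, hminH₂, hmaxX₂, hP₂, -, hW₂⟩ := himgF ω₂ b1 b2 b3
      rw [heq, hW₂] at h₁
      exact spliceUb_ne_bottom hω₂.1 hω₁.1 hminH₂ hmaxX₂ hminH₁ hmaxX₁ hP₂ h₁
    · exfalso
      obtain ⟨-, hnl, -⟩ := himgR ω₂ b1
      obtain ⟨-, hl, -⟩ := himgF ω₁ a1 a2 a3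
      rw [← heq] at hnl; exact hnl hl
    · exfalso
      obtain ⟨-, -, L₂, xb₂, j₂, k₂, fwd₂, hminH₂, hmaxX₂, h₂⟩ := himgB ω₂ b1 b2
      obtain ⟨-, -, L₁, xb₁, j₁, fwd₁, hminH₁, hmaxX₁, hP₁, -, hW₁⟩ := himgF ω₁ a1 a2 a3
      rw [← heq, hW₁] at h₂
      exact spliceUb_ne_bottom hω₁.1 hω₂.1 hminH₁ hmaxX₁ hminH₂ hmaxX₂ hP₁ h₂
    · obtain ⟨-, -, L₁, xb₁, j₁, fwd₁, hminH₁, hmaxX₁, h₁⟩ := himgF ω₁ a1 a2 a3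
      obtain ⟨-, -, L₂, xb₂, j₂, fwd₂, hminH₂, hmaxX₂, h₂⟩ := himgF ω₂ b1 b2 b3
      rw [heq] at h₁
      exact eq_of_floorSlide_image_eq hω₁.1 hω₂.1 hminH₁ hmaxX₁ hminH₂ hmaxX₂ h₁ h₂

/-- **Complement form**: `#canonEnd n − #{leaf polygons served neither at the bottom nor by the floor slide} ≤ #canonEnd (n+2)`.
[cite: MadrasSlade1993, §3.2, Theorem 3.2.3 / (3.2.3)] -/
theorem card_canonEnd_sub_card_filter_floorSlotResidue_le [DecidablePred (IsStepTwoFloorSlot n)]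
    [DecidablePred fun ω => IsTopLeaf n ω ∧ ¬ IsStepTwoBottom n ω ∧ ¬ IsFloorSlide n ω] (hn : 5 ≤ n) :
    #(canonEnd n) - #((canonEnd n).filter fun ω => IsTopLeaf n ω ∧ ¬ IsStepTwoBottom n ω ∧ ¬ IsFloorSlide n ω) ≤
      #(canonEnd (n + 2)) := by
  classical
  have hcover : canonEnd n ⊆ (canonEnd n).filter (IsStepTwoFloorSlot n) ∪
      (canonEnd n).filter (fun ω => IsTopLeaf n ω ∧ ¬ IsStepTwoBottom n ω ∧ ¬ IsFloorSlide n ω) := by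
    intro ω hω
    rcases isStepTwoRoof_or_isTopLeaf hω hn with h | h
    · exact Finset.mem_union_left _ (Finset.mem_filter.2 ⟨hω, Or.inl (Or.inl h)⟩)
    · by_cases hb : IsStepTwoBottom n ω
      · exact Finset.mem_union_left _ (Finset.mem_filter.2 ⟨hω, Or.inl (Or.inr ⟨h, hb⟩)⟩)
      · by_cases hs : IsFloorSlide n ω
        · exact Finset.mem_union_left _ (Finset.mem_filter.2 ⟨hω, Or.inr ⟨hs, h⟩⟩)
        · exact Finset.mem_union_right _ (Finset.mem_filter.2 ⟨hω, h, hb, hs⟩)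
  have h1 := (Finset.card_le_card hcover).trans (Finset.card_union_le _ _)
  have h2 := card_filter_isStepTwoFloorSlot_le (n := n) hn
  omega

/-- **Printed normalisation**: `q_{n+1}(ℍ) − #{floor-slot residue} ≤ q_{n+3}(ℍ)` (`n ≥ 5`). [cite: MadrasSlade1993, §3.2, Theorem 3.2.3 / (3.2.3)] -/
theorem hexPolygonNumber_sub_card_floorSlotResidue_le
    [DecidablePred fun ω => IsTopLeaf n ω ∧ ¬ IsStepTwoBottom n ω ∧ ¬ IsFloorSlide n ω] (hn : 5 ≤ n) :
    hexPolygonNumber (n + 1) - #((canonEnd n).filter fun ω => IsTopLeaf n ω ∧ ¬ IsStepTwoBottom n ω ∧ ¬ IsFloorSlide n ω) ≤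
      hexPolygonNumber (n + 3) := by
  classical
  have h := card_canonEnd_sub_card_filter_floorSlotResidue_le (n := n) hn
  rw [card_canonEnd (by omega), card_canonEnd (by omega)] at h
  exact h

end FloorSlot

end PolygonConcat

end HexBW

end Literature.Probability.RandomPlanarGeometry.SAW

end
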